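import Literature.MathematicalPhysics.QuantumFieldTheory.BalabanImbrieJaffe1984to88.BIJ88ChiFieldDeriv307
import Mathlib.Probability.Independence.Basic

/-!
# `BalabanImbrieJaffe1984to88.BIJ88GaussIntegration309Indep` — T. Bałaban, J. Imbrie, A. Jaffe, *Effective action and cluster
properties of the abelian Higgs model*, Commun. Math. Phys. **114** (1988) 257–315 [BalabanImbrieJaffe1988]: p. 309 [PDF 53] (Sect. 5.14,
proof of (5.14.4)), the located sentence *"Each t-derivative of a χ-factor in χ′_{Λ,t} gives at least a factor e^β(L^kε/ε₀)^{1/4−α}"*,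
together with p. 308 *"We express each d/dt as a sum Σ_Γ (d/dt)_Γ where (d/dt)_Γ acts only on the t before a particular term … or in a
particular χ-factor"* — the FACTOR-WISE derivatives `Π_{b∈B} (d/dt)^{m_b} χ(c_b·p(te_k), Φ_b)` of the product χ′_{Λ,t}.

statement-level skeleton of published theorems with citation tags; proofs where landed; nothing here is a claim about the Yang–Mills mass gap

WHAT THIS FILE ADDS to this seat's p. 309 chain (`BIJ88GaussIntegration309Product`: Leibniz for (d/dt)ⁿ of the whole product, ONE
Gaussian factor after integration; `BIJ88GaussIntegration309Law`: any Gaussian marginals).  Here each localized derivative (d/dt)_Γ hits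
its own χ-factor, as in (5.14.3): for a finite family `B` of factors with multiplicities `m_b ≥ 1` (`n = Σ_b m_b` derivatives in all):

* **§1 pointwise** — `|Π_{b∈B} (d/dt)^{m_b} χ_b| ≤ Π_{b∈B} Ĉ·t^{−m_b}·𝟙{(9/10)|c_b|p(te_k) ≤ |Φ_b| ≤ |c_b|p(te_k)}`
  (`abs_prod_iteratedDeriv_cutoff_t_le`: one constant `Ĉ(χ,p,n₀)` for all orders `≤ n₀`, from `…309Product.exists_const_all_orders`, and the
  support clause of `BIJ88ChiTDerivN309`) — EVERY differentiated factor must have its field in its shell.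
* **§2 MODEL INSTANCE: independent Gaussian marginals** — if the fields `Φ_b` are INDEPENDENT (Mathlib `iIndepFun`) with centered Gaussian
  laws of variances `≤ v` and `|c_b| ≥ c₀ > 0`, then after integration EACH differentiated χ-factor carries its own Gaussian factor:
  `∫ |Π_b (d/dt)^{m_b} χ_b| dP ≤ Π_{b∈B} (2Ĉ·t^{−m_b}·e^{−(81/200)(c₀²/v)p(te_k)²})` (`integral_abs_prod_iteratedDeriv_cutoff_t_le_of_indep`;
  `P(⋂_b shell_b) = Π_b P(shell_b)` by independence, each tail from `BIJ88ChiFieldDeriv307.real_abs_ge_le_of_variance_le`, degenerate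
  variances included), and in the printed e_k-small regime (`gauss309` of `BIJ88GaussFactor309` applied factor by factor)
  `≤ (e^β s^{1/4−α})^{Σ_b m_b}` — **n t-derivatives give n vertex factors** (`integral_abs_prod_iteratedDeriv_cutoff_t_le_vertexFactor_pow_of_indep`).
  HONEST SCOPE: the paper's fluctuation fields at different bonds are correlated Gaussians and the per-factor smallness there comes from
  the cluster expansion (*"the arguments at the end of Sect. 14 in [3]"*); independence is the HYPOTHESIS of this model instance, stated as
  such, under which the printed count of small factors is a theorem of elementary probability.

PDF held: `paper:balaban1988-cmp114-bij-abelian-higgs-effective-action` (journal page = PDF page + 256); pp. 308–309 [PDF 52–53].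

CITATION HEADER (lean-in-tree rule).  Part of the lit-balaban TYPED SKELETON (HOME `run/shared/lean/pub/lit-balaban/`), Phase 2,
seat p36 (gen 7, unit `lit-balaban-p36`); row **C2.Eq5.14.3-5.14.4** of `HOME/lit-balaban-r16/ROWS-C2-part2.md` (owner r16; the typed leaf
(5.14.4) `BIJ88Sect5StatementsPart2.Ineq5144` is NOT claimed).  Theorems only; no definitions, no `Prop` facts; axioms standard.
-/

namespace Literature.MathematicalPhysics.QuantumFieldTheory.BalabanImbrieJaffe1984to88.BIJ88GaussIntegration309Indep

open MeasureTheory ProbabilityTheory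
open BIJ88Sect2Statements (pLog eK)
open BIJ88Sect5Statements (CutoffProfile cutoff)
open scoped NNReal

/-! ## §1 Factor-wise t-derivatives of χ′: bound and support, pointwise -/

section Pointwise

variable (χ : CutoffProfile) {ι : Type*}

/-- **Each localized derivative on its own factor.**  For `n₀` there is `Ĉ = Ĉ(χ,p,n₀) ≥ 1` such that for every finite family `B`,
multiplicities `1 ≤ m_b ≤ n₀`, thresholds `c_b ≠ 0`, fields `A_b`, and `0 < e_k`, `0 < t`, `te_k ≤ e^{−1}`:
`|Π_{b∈B} (d/dt)^{m_b} χ(c_b·p(te_k), A_b)| ≤ Π_{b∈B} Ĉ·t^{−m_b}·𝟙{(9/10)|c_b|p(te_k) ≤ |A_b| ≤ |c_b|p(te_k)}`.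
[cite: BalabanImbrieJaffe1988, (5.14.4) p.309] -/
theorem abs_prod_iteratedDeriv_cutoff_t_le (p : ℝ) (n₀ : ℕ) :
    ∃ C : ℝ, 1 ≤ C ∧ ∀ (B : Finset ι) (m : ι → ℕ) (A c : ι → ℝ) ⦃ek t : ℝ⦄, (∀ b ∈ B, 1 ≤ m b ∧ m b ≤ n₀) → (∀ b ∈ B, c b ≠ 0) →
      0 < ek → 0 < t → t * ek ≤ Real.exp (-1) →
        |∏ b ∈ B, iteratedDeriv (m b) (fun s => cutoff χ (c b * pLog p (s * ek)) (A b)) t| ≤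
          ∏ b ∈ B, C * t⁻¹ ^ (m b) *
            Set.indicator {x : ℝ | 9 / 10 * (|c b| * pLog p (t * ek)) ≤ |x| ∧ |x| ≤ |c b| * pLog p (t * ek)} (fun _ => (1 : ℝ)) (A b) := by
  classical
  obtain ⟨C, hC1, hC⟩ := BIJ88GaussIntegration309Product.exists_const_all_orders χ p n₀
  refine ⟨C, hC1, fun B m A c ek t hm hc hek ht h1 => ?_⟩
  have h1' : t * ek < 1 := h1.trans_lt (by rw [← Real.exp_zero]; exact Real.exp_lt_exp.mpr (by norm_num))
  rw [Finset.abs_prod]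
  refine Finset.prod_le_prod (fun b _ => abs_nonneg _) fun b hb => ?_
  have hzpow : t ^ (-(m b : ℤ)) = t⁻¹ ^ (m b) := by rw [zpow_neg, zpow_natCast, inv_pow]
  by_cases hx : A b ∈ {x : ℝ | 9 / 10 * (|c b| * pLog p (t * ek)) ≤ |x| ∧ |x| ≤ |c b| * pLog p (t * ek)}
  · rw [Set.indicator_of_mem hx, mul_one, ← hzpow]
    exact hC (m b) (hm b hb).2 (A b) (hc b hb) hek ht h1
  · rw [Set.indicator_of_notMem hx, mul_zero]
    have h0 : iteratedDeriv (m b) (fun s => cutoff χ (c b * pLog p (s * ek)) (A b)) t = 0 := by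
      by_contra hne
      exact hx (BIJ88ChiTDerivN309.support_iteratedDeriv_cutoff_t χ p (hm b hb).1 (hc b hb) hek ht h1' hne)
    rw [h0, abs_zero]

/-- The product of the indicators is the indicator of "every differentiated field in its shell"; in particular the factor-wise
derivative VANISHES as soon as one differentiated factor has its field off its shell. [cite: BalabanImbrieJaffe1988, (5.14.4) p.309] -/
theorem prod_iteratedDeriv_cutoff_t_eq_zero (p : ℝ) (B : Finset ι) (m : ι → ℕ) (A c : ι → ℝ) {ek t : ℝ}
    (hm : ∀ b ∈ B, 1 ≤ m b) (hc : ∀ b ∈ B, c b ≠ 0) (hek : 0 < ek) (ht : 0 < t) (h1 : t * ek ≤ Real.exp (-1))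
    (hoff : ∃ b ∈ B, ¬ (9 / 10 * (|c b| * pLog p (t * ek)) ≤ |A b| ∧ |A b| ≤ |c b| * pLog p (t * ek))) :
    ∏ b ∈ B, iteratedDeriv (m b) (fun s => cutoff χ (c b * pLog p (s * ek)) (A b)) t = 0 := by
  obtain ⟨b, hb, hxb⟩ := hoff
  have h1' : t * ek < 1 := h1.trans_lt (by rw [← Real.exp_zero]; exact Real.exp_lt_exp.mpr (by norm_num))
  refine Finset.prod_eq_zero hb ?_
  by_contra hne
  exact hxb (BIJ88ChiTDerivN309.support_iteratedDeriv_cutoff_t χ p (hm b hb) (hc b hb) hek ht h1' hne)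

end Pointwise

/-! ## §2 Model instance: INDEPENDENT Gaussian marginals — one Gaussian factor per differentiated χ-factor -/

section Indep

variable (χ : CutoffProfile) {ι Ω : Type*} [MeasurableSpace Ω]

/-- Independence turns the shell events into a product: `P(⋂_{b∈B} {Φ_b ∈ T_b}) = Π_{b∈B} P{Φ_b ∈ T_b}` for measurable `T_b`.
[cite: BalabanImbrieJaffe1988, (5.14.4) p.309] -/
theorem measureReal_biInter_eq_prod_of_indep {P : Measure Ω} {Φ : ι → Ω → ℝ} (hInd : iIndepFun Φ P) (B : Finset ι)
    (T : ι → Set ℝ) (hT : ∀ b ∈ B, MeasurableSet (T b)) :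
    P.real (⋂ b ∈ B, {ω | Φ b ω ∈ T b}) = ∏ b ∈ B, P.real {ω | Φ b ω ∈ T b} := by
  have h := hInd.meas_biInter (S := B) (s := fun b => {ω | Φ b ω ∈ T b}) fun b hb =>
    MeasurableSpace.measurableSet_comap.mpr ⟨T b, hT b hb, rfl⟩
  simp only [measureReal_def]
  rw [h, ENNReal.toReal_prod]

/-- **p. 309, factor-wise, independent Gaussian marginals**: for `n₀` there is `Ĉ = Ĉ(χ,p,n₀) ≥ 1` such that on every probability space,
for INDEPENDENT real observables `Φ_b` with CENTERED Gaussian laws of variances `≤ v` (`0 < v`), thresholds `|c_b| ≥ c₀ > 0`,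
multiplicities `1 ≤ m_b ≤ n₀` on a finite family `B`, and `0 < e_k`, `0 < t`, `te_k ≤ e^{−1}`:
`∫ |Π_{b∈B} (d/dt)^{m_b} χ(c_b·p(te_k), Φ_b)| dP ≤ Π_{b∈B} (2Ĉ·t^{−m_b}·e^{−(81/200)(c₀²/v)·p(te_k)²})` — one Gaussian factor per
differentiated χ-factor. [cite: BalabanImbrieJaffe1988, (5.14.4) p.309] -/
theorem integral_abs_prod_iteratedDeriv_cutoff_t_le_of_indep (p : ℝ) (n₀ : ℕ) :
    ∃ C : ℝ, 1 ≤ C ∧ ∀ (P : Measure Ω) [IsProbabilityMeasure P] (B : Finset ι) (m : ι → ℕ) (Φ : ι → Ω → ℝ) (c : ι → ℝ)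
      (c₀ v : ℝ), iIndepFun Φ P → (∀ b ∈ B, HasGaussianLaw (Φ b) P) → (∀ b ∈ B, Measurable (Φ b)) → (∀ b ∈ B, P[Φ b] = 0) →
      0 < v → (∀ b ∈ B, Var[Φ b; P] ≤ v) → 0 < c₀ → (∀ b ∈ B, c₀ ≤ |c b|) → (∀ b ∈ B, 1 ≤ m b ∧ m b ≤ n₀) →
      ∀ ⦃ek t : ℝ⦄, 0 < ek → 0 < t → t * ek ≤ Real.exp (-1) →
        ∫ ω, |∏ b ∈ B, iteratedDeriv (m b) (fun s => cutoff χ (c b * pLog p (s * ek)) (Φ b ω)) t| ∂P ≤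
          ∏ b ∈ B, 2 * C * t⁻¹ ^ (m b) * Real.exp (-(81 / 200 * (c₀ ^ 2 / v) * pLog p (t * ek) ^ 2)) := by
  classical
  obtain ⟨C, hC1, hC⟩ := abs_prod_iteratedDeriv_cutoff_t_le (ι := ι) χ p n₀
  refine ⟨C, hC1, ?_⟩
  intro P _ B m Φ c c₀ v hInd hG hΦ h0 hv hvar hc₀ hcb hm ek t hek ht h1
  have hcne : ∀ b ∈ B, c b ≠ 0 := fun b hb h => by
    have := hcb b hb; rw [h, abs_zero] at this; linarith
  -- the shell sets and events
  set T : ι → Set ℝ := fun b => {x : ℝ | 9 / 10 * (|c b| * pLog p (t * ek)) ≤ |x| ∧ |x| ≤ |c b| * pLog p (t * ek)} with hT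
  have hTm : ∀ b, MeasurableSet (T b) := fun b =>
    (measurableSet_le measurable_const continuous_abs.measurable).inter (measurableSet_le continuous_abs.measurable measurable_const)
  set S : Set Ω := ⋂ b ∈ B, {ω | Φ b ω ∈ T b} with hS
  have hSm : MeasurableSet S := Finset.measurableSet_biInter B fun b hb => hΦ b hb (hTm b)
  -- the deterministic constant
  set K : ℝ := ∏ b ∈ B, C * t⁻¹ ^ (m b) with hK
  have hK0 : 0 ≤ K := Finset.prod_nonneg fun b _ => by positivity
  -- pointwise: |Π| ≤ K · 𝟙_S
  have hpt : ∀ ω, |∏ b ∈ B, iteratedDeriv (m b) (fun s => cutoff χ (c b * pLog p (s * ek)) (Φ b ω)) t| ≤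
      S.indicator (fun _ => K) ω := by
    intro ω
    refine (hC B m (fun b => Φ b ω) c hm hcne hek ht h1).trans ?_
    by_cases hω : ω ∈ S
    · rw [Set.indicator_of_mem hω, hK]
      refine Finset.prod_le_prod (fun b _ => ?_) fun b _ => ?_
      · exact mul_nonneg (by positivity) (Set.indicator_nonneg (fun _ _ => zero_le_one) _)
      · exact mul_le_of_le_one_right (by positivity) (Set.indicator_apply_le' (fun _ => le_rfl) fun _ => zero_le_one)
    · rw [Set.indicator_of_notMem hω]
      have : ∃ b ∈ B, Φ b ω ∉ T b := by
        by_contra hall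
        exact hω (Set.mem_iInter₂.mpr fun b hb => by by_contra h; exact hall ⟨b, hb, h⟩)
      obtain ⟨b, hb, hbT⟩ := this
      rw [Finset.prod_eq_zero hb (by rw [Set.indicator_of_notMem hbT, mul_zero])]
  have hint : Integrable (S.indicator fun _ => K) P := (integrable_const K).indicator hSm
  -- integrate and use independence
  have hI : ∫ ω, |∏ b ∈ B, iteratedDeriv (m b) (fun s => cutoff χ (c b * pLog p (s * ek)) (Φ b ω)) t| ∂P ≤ K * P.real S := by
    calc ∫ ω, |∏ b ∈ B, iteratedDeriv (m b) (fun s => cutoff χ (c b * pLog p (s * ek)) (Φ b ω)) t| ∂P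
        ≤ ∫ ω, S.indicator (fun _ => K) ω ∂P :=
          integral_mono_of_nonneg (Filter.Eventually.of_forall fun ω => abs_nonneg _) hint (Filter.Eventually.of_forall hpt)
      _ = P.real S * K := by rw [integral_indicator_const K hSm, smul_eq_mul]
      _ = K * P.real S := mul_comm _ _
  have hprod : P.real S = ∏ b ∈ B, P.real {ω | Φ b ω ∈ T b} :=
    measureReal_biInter_eq_prod_of_indep hInd B T fun b _ => hTm b
  -- each marginal shell probability ≤ tail ≤ 2e^{−(81/200)(c₀²/v)p²}
  have htail : ∀ b ∈ B, P.real {ω | Φ b ω ∈ T b} ≤ 2 * Real.exp (-(81 / 200 * (c₀ ^ 2 / v) * pLog p (t * ek) ^ 2)) := by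
    intro b hb
    have htek : 0 < t * ek := mul_pos ht hek
    have h1' : t * ek < 1 := h1.trans_lt (by rw [← Real.exp_zero]; exact Real.exp_lt_exp.mpr (by norm_num))
    have hL : 0 < -Real.log (t * ek) := by have := Real.log_neg htek h1'; linarith
    have hpl : 0 < pLog p (t * ek) := by
      rw [BIJ88ChiTDeriv309.pLog_eq_rpow_neg_log p htek h1']; exact Real.rpow_pos_of_pos hL p
    have hq : c b * pLog p (t * ek) ≠ 0 := mul_ne_zero (hcne b hb) hpl.ne'
    have hsub : {ω | Φ b ω ∈ T b} ⊆ {ω | 9 / 10 * |c b * pLog p (t * ek)| ≤ |Φ b ω|} := by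
      intro ω hω
      have h := hω.1
      simp only [Set.mem_setOf_eq]
      rwa [abs_mul, abs_of_pos hpl]
    refine (measureReal_mono hsub).trans ?_
    refine (BIJ88ChiFieldDeriv307.real_abs_ge_le_of_variance_le (hG b hb) (hΦ b hb) (h0 b hb) (hvar b hb) hq).trans ?_
    refine mul_le_mul_of_nonneg_left (Real.exp_le_exp.mpr ?_) (by norm_num)
    rw [neg_le_neg_iff]
    have hcc : c₀ ^ 2 ≤ c b ^ 2 := by
      have := pow_le_pow_left₀ hc₀.le (hcb b hb) 2; rwa [sq_abs] at this
    have hp2 : 0 ≤ pLog p (t * ek) ^ 2 := by positivity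
    rw [mul_pow]
    have hdiv : c₀ ^ 2 / v ≤ c b ^ 2 / v := div_le_div_of_nonneg_right hcc hv.le
    calc 81 / 200 * (c₀ ^ 2 / v) * pLog p (t * ek) ^ 2 ≤ 81 / 200 * (c b ^ 2 / v) * pLog p (t * ek) ^ 2 :=
          mul_le_mul_of_nonneg_right (mul_le_mul_of_nonneg_left hdiv (by norm_num)) hp2
      _ = 81 / 200 * (c b ^ 2 * pLog p (t * ek) ^ 2) / v := by ring
  have hPS : P.real S ≤ ∏ b ∈ B, 2 * Real.exp (-(81 / 200 * (c₀ ^ 2 / v) * pLog p (t * ek) ^ 2)) := by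
    rw [hprod]
    exact Finset.prod_le_prod (fun b _ => measureReal_nonneg) htail
  calc ∫ ω, |∏ b ∈ B, iteratedDeriv (m b) (fun s => cutoff χ (c b * pLog p (s * ek)) (Φ b ω)) t| ∂P
      ≤ K * P.real S := hI
    _ ≤ K * ∏ b ∈ B, 2 * Real.exp (-(81 / 200 * (c₀ ^ 2 / v) * pLog p (t * ek) ^ 2)) := mul_le_mul_of_nonneg_left hPS hK0
    _ = ∏ b ∈ B, 2 * C * t⁻¹ ^ (m b) * Real.exp (-(81 / 200 * (c₀ ^ 2 / v) * pLog p (t * ek) ^ 2)) := by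
        rw [hK, ← Finset.prod_mul_distrib]
        refine Finset.prod_congr rfl fun b _ => ?_
        ring

/-- **"Each t-derivative of a χ-factor in χ′_{Λ,t} gives at least a factor e^β(L^kε/ε₀)^{1/4−α}" — n derivatives, n vertex factors**
(model instance: independent centered Gaussian marginals, charge reading of `e^β`).  With `e_k = eK L ε e d k`, `L^kε = sε₀`
(`0 < s ≤ 1`, `0 < ε₀ ≤ 1`), `0 < e ≤ 1`, `β ≤ 1`, `0 ≤ α`, `d < 4`, `1/2 < p`, `0 < t ≤ 1`, `e_k ≤ e^{−1}`, variances `≤ v`, `|c_b| ≥ c₀ > 0`,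
multiplicities `1 ≤ m_b ≤ n₀`, and the printed e_k-small regime `n₀ + 1 ≤ (81c₀²/(200v))|log e_k⁻¹|^{2p−1}`, `2Ĉ·e_k ≤ 1`:
`∫ |Π_{b∈B} (d/dt)^{m_b} χ(c_b·p(te_k), Φ_b)| dP ≤ (e^β s^{1/4−α})^{Σ_{b∈B} m_b}`. [cite: BalabanImbrieJaffe1988, (5.14.4) p.309] -/
theorem integral_abs_prod_iteratedDeriv_cutoff_t_le_vertexFactor_pow_of_indep (p : ℝ) (n₀ : ℕ) :
    ∃ C : ℝ, 1 ≤ C ∧ ∀ (P : Measure Ω) [IsProbabilityMeasure P] (B : Finset ι) (m : ι → ℕ) (Φ : ι → Ω → ℝ) (c : ι → ℝ)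
      (c₀ v : ℝ) ⦃L ε e s ε₀ t α β : ℝ⦄ ⦃d k : ℕ⦄, iIndepFun Φ P → (∀ b ∈ B, HasGaussianLaw (Φ b) P) → (∀ b ∈ B, Measurable (Φ b)) →
      (∀ b ∈ B, P[Φ b] = 0) → 0 < v → (∀ b ∈ B, Var[Φ b; P] ≤ v) → 0 < c₀ → (∀ b ∈ B, c₀ ≤ |c b|) → (∀ b ∈ B, 1 ≤ m b ∧ m b ≤ n₀) →
      0 < L → 0 < ε → 0 < e → e ≤ 1 → β ≤ 1 → 0 ≤ α → d < 4 → 0 < s → s ≤ 1 → 0 < ε₀ → ε₀ ≤ 1 → L ^ k * ε = s * ε₀ →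
      0 < t → t ≤ 1 → 1 / 2 < p → eK L ε e d k ≤ Real.exp (-1) →
      ((n₀ : ℝ) + 1 ≤ 81 / 200 * (c₀ ^ 2 / v) * Real.log (eK L ε e d k)⁻¹ ^ (2 * p - 1)) → 2 * C * eK L ε e d k ≤ 1 →
        ∫ ω, |∏ b ∈ B, iteratedDeriv (m b) (fun σ => cutoff χ (c b * pLog p (σ * eK L ε e d k)) (Φ b ω)) t| ∂P ≤
          (e ^ β * s ^ (1 / 4 - α)) ^ (∑ b ∈ B, m b) := by
  obtain ⟨C, hC1, hC⟩ := integral_abs_prod_iteratedDeriv_cutoff_t_le_of_indep (ι := ι) (Ω := Ω) χ p n₀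
  refine ⟨C, hC1, ?_⟩
  intro P _ B m Φ c c₀ v L ε e s ε₀ t α β d k hInd hG hΦ h0 hv hvar hc₀ hcb hm hL hε he0 he1 hβ1 hα hd hs0 hs1 hε₀0 hε₀1
    hLε ht0 ht1 hp hek1 hreg hsmall
  have hek : 0 < eK L ε e d k := BIJ88ScaleSums.eK_pos hL hε he0 k
  have h1 : t * eK L ε e d k ≤ Real.exp (-1) := (mul_le_of_le_one_left hek.le ht1).trans hek1
  refine (hC P B m Φ c c₀ v hInd hG hΦ h0 hv hvar hc₀ hcb hm hek ht0 h1).trans ?_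
  rw [← Finset.prod_pow_eq_pow_sum]
  refine Finset.prod_le_prod (fun b _ => by positivity) fun b hb => ?_
  -- per factor: 2C t^{−m_b} e^{−c p(te_k)²} ≤ (e^β s^{1/4−α})^{m_b} by `gauss309` (regime: m_b + 1 ≤ n₀ + 1 ≤ …)
  have hregb : ((m b : ℕ) : ℝ) + 1 ≤ 81 / 200 * (c₀ ^ 2 / v) * Real.log (eK L ε e d k)⁻¹ ^ (2 * p - 1) := by
    have : ((m b : ℕ) : ℝ) ≤ n₀ := by exact_mod_cast (hm b hb).2
    linarith
  have hg := BIJ88GaussFactor309.gauss309 (n := m b) (c' := 2 * C) (c := 81 / 200 * (c₀ ^ 2 / v)) hL hε he0 he1 hβ1 hα hd hs0 hs1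
    hε₀0 hε₀1 hLε ht0 ht1 hp (by positivity) (by positivity) hregb hsmall
  refine le_trans (le_of_eq ?_) hg
  rw [inv_pow]
  ring

end Indep

end Literature.MathematicalPhysics.QuantumFieldTheory.BalabanImbrieJaffe1984to88.BIJ88GaussIntegration309Indep
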